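import Summits.QuantumFields.BalabanUV.T4Continuum.Support.AveragingDeficitCovGrad
import Summits.QuantumFields.BalabanUV.T4Continuum.Support.BlockAveragePushDirGauge
import Summits.QuantumFields.BalabanUV.T4Continuum.Support.NE3SpreadLiftCurl
import HarnessLib

/-!
# T⁴ programme, node NE3, row NE3-R2 (gen 7) — THE COVARIANT LATTICE STOKES IDENTITY FOR 0-FORMS:
# the commutator of a 0-form with a plaquette variable IS the covariant circulation of its covariant differences,
# `‖Ad_{U(∂p)} λ(x) − λ(x)‖ ≤ Σ_{b ∈ ∂p} ‖gaugeDir U λ b‖`, and on the torus `Σ_{x,π} ‖Ad_{U(∂p)} λ − λ‖² ≤ 16·d·dirSq (gaugeDir U λ)`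

HONEST FRAMING (cell `pub-balaban`, T4-DAG PAGE 1; unit `b2b-balaban-t4-ne3r2-p1` = owner of BINDER-OWNERS row NE3-R2, gen 7;
journal ONLINE∕INTENT 2026-08-20T16:30Z).  The cell's T4 target is the finite-torus continuum limit of the unit-scale averaged loop
expectations — NOT infinite volume, NO mass gap, NOT Clay, NOT summit progress.

WHY.  The NE3 owner's ruling ρ-g21-4 (`HOME/CLAIMS.log` 2026-08-20T15:46Z, (W5)) types the CURVED wall of the (P♮)∕(ML_w)
programme as two inequalities, one of which — this row's located point **(μK-FR)** (memo
`HOME/t4/b2b-balaban-t4-ne3r2-p1/gen6/F-ne3r2-g6-muK2.md` §A) — reads «`Σ_{z,κ} ‖[Φ^{coh}_{z,κ}, μ(z)]‖² ≤ C·Σ_{z,κ} ‖D_U μ(z,κ)‖² +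
(lower order)`», `Φ^{coh}` the COARSE plaquette fluxes of the coarse field `U` whose covariant differences `D_U μ` the tangency
reading controls (`NE3CovariantLineSums`: `S_W = −gaugeDir U μ + E`).  With `Φ^{coh}` read as the plaquette variables of that
SAME field `U`, the inequality is not an estimate but the lattice STOKES IDENTITY, exact at every unitary background, with NO
lower-order term and NO smallness: walking around `∂p` with `λ(y + e_μ) = Ad_{U(y,μ)⁻¹} λ(y) − gaugeDir U λ (y,μ)` along the
two paths `x → x+e_μ → x+e_μ+e_ν` and `x → x+e_ν → x+e_ν+e_μ` and comparing gives
`Ad_{U(∂p)⁻¹} λ(x) − λ(x) = Ad_{U(x,ν)U(x+e_ν,μ)} [Ad_{U(x+e_μ,ν)⁻¹} g(x,μ) + g(x+e_μ,ν) − Ad_{U(x+e_ν,μ)⁻¹} g(x,ν) − g(x+e_ν,μ)]`,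
`g := gaugeDir U λ` (§1, pure group algebra), hence for unitary `U` the four-term norm bound, its `Ad_{U(∂p)}` and commutator
forms `‖[U(∂p), λ(x)]‖ = ‖[U(∂p) − 1, λ(x)]‖ ≤ Σ_{b∈∂p} ‖g(b)‖` (§2), and on one period of a periodic `U`, `λ`
`Σ_{x ∈ periodBox M} Σ_π ‖Ad_{U(∂p(x,π))} λ(x) − λ(x)‖² ≤ 16·d·dirSq (gaugeDir U λ) (periodBox M)` (§3, planes over-counted by
ordered pairs through leaf-01's `NE3SpreadLiftCurl.sum_fourNorm_sq_le`).  WHAT THIS SETTLES AND WHAT IT DOES NOT (gen-7 FINDING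
F-ne3r2-g7-1, memo `HOME/t4/b2b-balaban-t4-ne3r2-p1/gen7/F-ne3r2-g7-FR.md`): the COARSE-LOOP half of (μK-FR) is this identity;
the substantive half — comparing the FINE comb-loop holonomies inside a block with the coarse plaquette holonomies at its corner —
is NOT a consequence and is false pointwise at coarse-abelian ∕ fine-non-abelian backgrounds (memo §2).  Nothing here is
specific to Bałaban's minimisers.

CONTENT (all [folklore]; 0 `def`, 0 sorry):
§1 `Ad_sub_Ad`, `next_eq` (one covariant step), **`Ad_holInv_sub_eq`** (the exact identity above);
§2 **`norm_Ad_holInv_sub_le`**, **`norm_Ad_hol_sub_le`** (`‖Ad_{U(∂p)^{∓1}} λ(x) − λ(x)‖ ≤` four `gaugeDir` norms),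
   `norm_comm_hol_le` (`‖U(∂p)·λ(x) − λ(x)·U(∂p)‖ ≤` the same), `norm_Ad_hol_sub_le_of_uniform` (`≤ 4·g` under a uniform bound);
§3 `isPeriodicDir_gaugeDir`, **`sum_norm_Ad_fhol_sub_sq_le`** (the torus form, constant `16·d`);
§4 (v1.1, append-only) the STRAIGHT-LINE form (route H♮ ρ-g22-2 step S3 ∕ row K3: «covariant line sums of an exact field telescope
EXACTLY»): **`Ad_hol_seg_sub_eq`** (`Ad_{U([x, x+me_κ])} λ(x + me_κ) − λ(x) = −Σ_{i<m} Ad_{U([x, x+ie_κ])·U(x+ie_κ,κ)} g(x + ie_κ, κ)`),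
`hol_seg_mem_unitaryUnits`, **`norm_Ad_hol_seg_sub_le`** (`≤ Σ_{i<m} ‖g(x + ie_κ, κ)‖`, unitary `U`).

PLACEMENT: `Summits/QuantumFields/BalabanUV/`; imports row NE3-R2's `AveragingDeficitCovGrad` (`hol_plaqWord_units`, `Ad` kit),
leaf-10's `BlockAveragePushDirGauge` (`gaugeDir`) and leaf-01's `NE3SpreadLiftCurl` (`sum_fourNorm_sq_le`) BY NAME; moves nothing.
HONEST: (P♮)∕(ML_w) at `W ≠ 1`, T-E_w and **NE3 are NOT proved**; spine PROVED 0∕9; finite T⁴ rung (B)+1 — NOT infinite volume,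
NOT mass gap, NOT `BetaPertH`, NOT Clay.
HONEST DEPENDENCY (cell page 1): continuum YM on T⁴ ⇐ BetaPertH ∧ nine spine estimates (0/9 proved); BetaPertH ⇐ (D1) ∧ (D4) ∧
CAP+tail; G-an2-4 gates asym, D1 and NE2/3/4.
-/

set_option autoImplicit false

open scoped BigOperators Matrix Matrix.Norms.L2Operator
open NormedSpace Finset

namespace Summit.QuantumFields.BalabanUV.T4Continuum.NE3CovariantStokes

open Literature.MathematicalPhysics.QuantumFieldTheory.Balaban1983to89
open B7Prop1Explicit B7Prop2Explicit
open T4AveragingDeficitWall hiding Site Plane Plaq Bond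
open T4AveragingDeficitWallBoundary (periodBox IsPeriodicCfg)
open T4AveragingDeficitNonAbelian (Ad_mul Ad_sub)
open AveragingDeficitPeriodicCounting (IsPeriodicDir)
open AveragingDeficitTransport (norm_Ad_of_unitary Ad_mul_val)
open AveragingDeficitNearIdentity (Ad_one Ad_add Ad_neg)
open AveragingDeficitCovGrad (hol_plaqWord_units)
open BlockAveragePushDirGauge (gaugeDir)
open NE3SpreadLiftCurl (sum_fourNorm_sq_le)

noncomputable section

variable {d : ℕ} {n : Type*} [Fintype n] [DecidableEq n]

/-! ## §1 The exact identity (any group of units, no unitarity) -/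

/-- `Ad_a X − Ad_b X = Ad_b (Ad_{b⁻¹ a} X − X)`. [folklore] -/
theorem Ad_sub_Ad (a b : (Matrix n n ℂ)ˣ) (X : Matrix n n ℂ) : Ad a X - Ad b X = Ad b (Ad (b⁻¹ * a) X - X) := by
  rw [Ad_sub, ← Ad_mul, mul_inv_cancel_left]

/-- ONE COVARIANT STEP: `λ(y + e_μ) = Ad_{U(y,μ)⁻¹} λ(y) − gaugeDir U λ (y,μ)` (the definition of `gaugeDir`, rearranged). [folklore] -/
theorem next_eq (U : Site d → Fin d → (Matrix n n ℂ)ˣ) (lam : Site d → Matrix n n ℂ) (y : Site d) (μ : Fin d) :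
    lam (y + e μ) = Ad (U y μ)⁻¹ (lam y) - gaugeDir U lam y μ := by
  simp only [gaugeDir]; abel

/-- TWO COVARIANT STEPS: `λ(y + e_μ + e_ν) = Ad_{(U(y,μ)U(y+e_μ,ν))⁻¹} λ(y) − Ad_{U(y+e_μ,ν)⁻¹} g(y,μ) − g(y+e_μ,ν)`, `g = gaugeDir U λ`.
[folklore] -/
theorem next_next_eq (U : Site d → Fin d → (Matrix n n ℂ)ˣ) (lam : Site d → Matrix n n ℂ) (y : Site d) (μ ν : Fin d) :
    lam (y + e μ + e ν) = Ad (U y μ * U (y + e μ) ν)⁻¹ (lam y)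
      - Ad (U (y + e μ) ν)⁻¹ (gaugeDir U lam y μ) - gaugeDir U lam (y + e μ) ν := by
  rw [next_eq U lam (y + e μ) ν, next_eq U lam y μ, Ad_sub, mul_inv_rev, Ad_mul]

/-- **THE COVARIANT STOKES IDENTITY FOR 0-FORMS ON A PLAQUETTE.**  For ANY configuration of units `U` and any 0-form `λ`,
with `g := gaugeDir U λ` and the plaquette variable `U(∂p) = U(x,μ)U(x+e_μ,ν)U(x+e_ν,μ)⁻¹U(x,ν)⁻¹` (`hol U x (plaqWord μ ν)`):
`Ad_{U(∂p)⁻¹} λ(x) − λ(x) = Ad_{U(x,ν)U(x+e_ν,μ)} [Ad_{U(x+e_μ,ν)⁻¹} g(x,μ) + g(x+e_μ,ν) − Ad_{U(x+e_ν,μ)⁻¹} g(x,ν) − g(x+e_ν,μ)]` —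
the two two-step transports of `λ(x)` to the opposite corner differ by the circulation of `g`. [folklore] -/
theorem Ad_holInv_sub_eq (U : Site d → Fin d → (Matrix n n ℂ)ˣ) (lam : Site d → Matrix n n ℂ) (x : Site d) (μ ν : Fin d) :
    Ad (hol U x (plaqWord μ ν))⁻¹ (lam x) - lam x
      = Ad (U x ν * U (x + e ν) μ)
          (Ad (U (x + e μ) ν)⁻¹ (gaugeDir U lam x μ) + gaugeDir U lam (x + e μ) ν
            - Ad (U (x + e ν) μ)⁻¹ (gaugeDir U lam x ν) - gaugeDir U lam (x + e ν) μ) := by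
  -- the two paths to the opposite corner
  have h₁ := next_next_eq U lam x μ ν
  have h₂ := next_next_eq U lam x ν μ
  rw [add_right_comm] at h₂
  -- their difference
  have hdiff : Ad (U x μ * U (x + e μ) ν)⁻¹ (lam x) - Ad (U x ν * U (x + e ν) μ)⁻¹ (lam x)
      = Ad (U (x + e μ) ν)⁻¹ (gaugeDir U lam x μ) + gaugeDir U lam (x + e μ) ν
          - Ad (U (x + e ν) μ)⁻¹ (gaugeDir U lam x ν) - gaugeDir U lam (x + e ν) μ := by
    have h12 := h₁.symm.trans h₂
    -- `A - p - q = B - r - s` ⇒ `A - B = p + q - r - s`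
    calc Ad (U x μ * U (x + e μ) ν)⁻¹ (lam x) - Ad (U x ν * U (x + e ν) μ)⁻¹ (lam x)
        = (Ad (U x μ * U (x + e μ) ν)⁻¹ (lam x) - Ad (U (x + e μ) ν)⁻¹ (gaugeDir U lam x μ) - gaugeDir U lam (x + e μ) ν)
            + Ad (U (x + e μ) ν)⁻¹ (gaugeDir U lam x μ) + gaugeDir U lam (x + e μ) ν
            - Ad (U x ν * U (x + e ν) μ)⁻¹ (lam x) := by abel
      _ = (Ad (U x ν * U (x + e ν) μ)⁻¹ (lam x) - Ad (U (x + e ν) μ)⁻¹ (gaugeDir U lam x ν) - gaugeDir U lam (x + e ν) μ)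
            + Ad (U (x + e μ) ν)⁻¹ (gaugeDir U lam x μ) + gaugeDir U lam (x + e μ) ν
            - Ad (U x ν * U (x + e ν) μ)⁻¹ (lam x) := by rw [h12]
      _ = _ := by abel
  rw [Ad_sub_Ad, inv_inv] at hdiff
  -- `(U₄U₃)·(U₁U₂)⁻¹ = U(∂p)⁻¹`
  have hgrp : U x ν * U (x + e ν) μ * (U x μ * U (x + e μ) ν)⁻¹ = (hol U x (plaqWord μ ν))⁻¹ := by
    rw [hol_plaqWord_units]; group
  rw [hgrp] at hdiff
  rw [← hdiff, ← Ad_mul, mul_inv_cancel, Ad_one]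

/-! ## §2 The norm forms (unitary `U`) -/

/-- **`‖Ad_{U(∂p)⁻¹} λ(x) − λ(x)‖ ≤ ‖g(x,μ)‖ + ‖g(x+e_μ,ν)‖ + ‖g(x+e_ν,μ)‖ + ‖g(x,ν)‖`**, `g = gaugeDir U λ`, for unitary `U`
(`Ad` by a unitary is an isometry). [folklore] -/
theorem norm_Ad_holInv_sub_le {U : Site d → Fin d → (Matrix n n ℂ)ˣ} (hU : IsUnitaryCfg U) (lam : Site d → Matrix n n ℂ)
    (x : Site d) (μ ν : Fin d) :
    ‖Ad (hol U x (plaqWord μ ν))⁻¹ (lam x) - lam x‖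
      ≤ ‖gaugeDir U lam x μ‖ + ‖gaugeDir U lam (x + e μ) ν‖ + ‖gaugeDir U lam (x + e ν) μ‖ + ‖gaugeDir U lam x ν‖ := by
  have hinv : ∀ y κ, (U y κ)⁻¹ ∈ unitaryUnits (Matrix n n ℂ) := fun y κ => (unitaryUnits (Matrix n n ℂ)).inv_mem (hU y κ)
  rw [Ad_holInv_sub_eq, norm_Ad_of_unitary ((unitaryUnits (Matrix n n ℂ)).mul_mem (hU x ν) (hU (x + e ν) μ))]
  have e1 : ‖Ad (U (x + e μ) ν)⁻¹ (gaugeDir U lam x μ)‖ = ‖gaugeDir U lam x μ‖ := norm_Ad_of_unitary (hinv _ _) _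
  have e2 : ‖Ad (U (x + e ν) μ)⁻¹ (gaugeDir U lam x ν)‖ = ‖gaugeDir U lam x ν‖ := norm_Ad_of_unitary (hinv _ _) _
  calc ‖Ad (U (x + e μ) ν)⁻¹ (gaugeDir U lam x μ) + gaugeDir U lam (x + e μ) ν
          - Ad (U (x + e ν) μ)⁻¹ (gaugeDir U lam x ν) - gaugeDir U lam (x + e ν) μ‖
      ≤ ‖Ad (U (x + e μ) ν)⁻¹ (gaugeDir U lam x μ)‖ + ‖gaugeDir U lam (x + e μ) ν‖
          + ‖Ad (U (x + e ν) μ)⁻¹ (gaugeDir U lam x ν)‖ + ‖gaugeDir U lam (x + e ν) μ‖ := by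
        refine (norm_sub_le _ _).trans ?_
        refine add_le_add ((norm_sub_le _ _).trans (add_le_add (norm_add_le _ _) le_rfl)) le_rfl
    _ = _ := by rw [e1, e2]; ring

/-- `Ad_u X − X = −Ad_u (Ad_{u⁻¹} X − X)`. [folklore] -/
theorem Ad_sub_self_eq (u : (Matrix n n ℂ)ˣ) (X : Matrix n n ℂ) : Ad u X - X = -Ad u (Ad u⁻¹ X - X) := by
  rw [Ad_sub, ← Ad_mul, mul_inv_cancel, Ad_one]; abel

/-- **`‖Ad_{U(∂p)} λ(x) − λ(x)‖ ≤ ‖g(x,μ)‖ + ‖g(x+e_μ,ν)‖ + ‖g(x+e_ν,μ)‖ + ‖g(x,ν)‖`** (the same bound for the plaquette variable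
itself: `Ad_u X − X = −Ad_u(Ad_{u⁻¹}X − X)`). [folklore] -/
theorem norm_Ad_hol_sub_le {U : Site d → Fin d → (Matrix n n ℂ)ˣ} (hU : IsUnitaryCfg U) (lam : Site d → Matrix n n ℂ)
    (x : Site d) (μ ν : Fin d) :
    ‖Ad (hol U x (plaqWord μ ν)) (lam x) - lam x‖
      ≤ ‖gaugeDir U lam x μ‖ + ‖gaugeDir U lam (x + e μ) ν‖ + ‖gaugeDir U lam (x + e ν) μ‖ + ‖gaugeDir U lam x ν‖ := by
  have hhol : hol U x (plaqWord μ ν) ∈ unitaryUnits (Matrix n n ℂ) := by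
    rw [hol_plaqWord_units]
    exact (unitaryUnits _).mul_mem ((unitaryUnits _).mul_mem ((unitaryUnits _).mul_mem (hU _ _) (hU _ _))
      ((unitaryUnits _).inv_mem (hU _ _))) ((unitaryUnits _).inv_mem (hU _ _))
  rw [Ad_sub_self_eq, norm_neg, norm_Ad_of_unitary hhol]
  exact norm_Ad_holInv_sub_le hU lam x μ ν

/-- COMMUTATOR FORM: `‖U(∂p)·λ(x) − λ(x)·U(∂p)‖ ≤ Σ_{b∈∂p} ‖g(b)‖` (for unitary `U(∂p)`, `[U(∂p), λ] = (Ad_{U(∂p)}λ − λ)·U(∂p)`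
and right multiplication by a unitary is an isometry; note `[U(∂p) − 1, λ] = [U(∂p), λ]`). [folklore] -/
theorem norm_comm_hol_le {U : Site d → Fin d → (Matrix n n ℂ)ˣ} (hU : IsUnitaryCfg U) (lam : Site d → Matrix n n ℂ)
    (x : Site d) (μ ν : Fin d) :
    ‖((hol U x (plaqWord μ ν) : (Matrix n n ℂ)ˣ) : Matrix n n ℂ) * lam x
        - lam x * ((hol U x (plaqWord μ ν) : (Matrix n n ℂ)ˣ) : Matrix n n ℂ)‖
      ≤ ‖gaugeDir U lam x μ‖ + ‖gaugeDir U lam (x + e μ) ν‖ + ‖gaugeDir U lam (x + e ν) μ‖ + ‖gaugeDir U lam x ν‖ := by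
  have hhol : hol U x (plaqWord μ ν) ∈ unitaryUnits (Matrix n n ℂ) := by
    rw [hol_plaqWord_units]
    exact (unitaryUnits _).mul_mem ((unitaryUnits _).mul_mem ((unitaryUnits _).mul_mem (hU _ _) (hU _ _))
      ((unitaryUnits _).inv_mem (hU _ _))) ((unitaryUnits _).inv_mem (hU _ _))
  have hcomm : ((hol U x (plaqWord μ ν) : (Matrix n n ℂ)ˣ) : Matrix n n ℂ) * lam x
        - lam x * ((hol U x (plaqWord μ ν) : (Matrix n n ℂ)ˣ) : Matrix n n ℂ)
      = (Ad (hol U x (plaqWord μ ν)) (lam x) - lam x) * ((hol U x (plaqWord μ ν) : (Matrix n n ℂ)ˣ) : Matrix n n ℂ) := by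
    rw [sub_mul, Ad_mul_val]
  rw [hcomm, CStarRing.norm_mul_mem_unitary _ (mem_unitaryUnits.mp hhol)]
  exact norm_Ad_hol_sub_le hU lam x μ ν

/-- Under a UNIFORM bound `‖gaugeDir U λ (y,κ)‖ ≤ g` on the four bonds of `∂p`: `‖Ad_{U(∂p)} λ(x) − λ(x)‖ ≤ 4·g` — a 0-form that is
covariantly constant to accuracy `g` commutes with every plaquette variable to accuracy `4g`. [folklore] -/
theorem norm_Ad_hol_sub_le_of_uniform {U : Site d → Fin d → (Matrix n n ℂ)ˣ} (hU : IsUnitaryCfg U) (lam : Site d → Matrix n n ℂ)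
    (x : Site d) (μ ν : Fin d) {g : ℝ}
    (h₁ : ‖gaugeDir U lam x μ‖ ≤ g) (h₂ : ‖gaugeDir U lam (x + e μ) ν‖ ≤ g) (h₃ : ‖gaugeDir U lam (x + e ν) μ‖ ≤ g)
    (h₄ : ‖gaugeDir U lam x ν‖ ≤ g) :
    ‖Ad (hol U x (plaqWord μ ν)) (lam x) - lam x‖ ≤ 4 * g := by
  have := norm_Ad_hol_sub_le hU lam x μ ν
  linarith

/-! ## §3 The torus form -/

/-- `gaugeDir U λ` of `M`-periodic data is an `M`-periodic direction field. [folklore] -/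
theorem isPeriodicDir_gaugeDir {U : Site d → Fin d → (Matrix n n ℂ)ˣ} {lam : Site d → Matrix n n ℂ} {M : ℤ}
    (hU : IsPeriodicCfg U M) (hlam : ∀ (x : Site d) (κ : Fin d), lam (x + M • e κ) = lam x) :
    IsPeriodicDir (gaugeDir U lam) M := by
  intro x κ μ
  simp only [gaugeDir]
  rw [hU x κ μ, hlam x κ, add_right_comm, hlam (x + e μ) κ]

/-- **THE TORUS FORM («frustration ≤ covariant Laplacian»).**  For a unitary `M`-periodic `U` and an `M`-periodic 0-form `λ`:
`Σ_{x ∈ periodBox M} Σ_{π} ‖Ad_{U(∂p(x,π))} λ(x) − λ(x)‖² ≤ 16·d·dirSq (gaugeDir U λ) (periodBox M)` — the total failure of `λ` to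
commute with the plaquette variables of one period is bounded by the `ℓ²` energy of its covariant differences (planes over-counted
by ordered pairs, leaf-01's `sum_fourNorm_sq_le`).  No smallness, no lower-order term. [folklore] -/
theorem sum_norm_Ad_fhol_sub_sq_le {M : ℕ} (hM : 1 ≤ M) {U : Site d → Fin d → (Matrix n n ℂ)ˣ} (hU : IsUnitaryCfg U)
    (hUp : IsPeriodicCfg U (M : ℤ)) {lam : Site d → Matrix n n ℂ} (hlam : ∀ (x : Site d) (κ : Fin d), lam (x + (M : ℤ) • e κ) = lam x) :
    ∑ x ∈ periodBox M, ∑ π : T4AveragingDeficitWall.Plane d, ‖Ad (fhol U (x, π)) (lam x) - lam x‖ ^ 2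
      ≤ 16 * d * dirSq (gaugeDir U lam) (periodBox M) := by
  refine le_trans ?_ (sum_fourNorm_sq_le hM (isPeriodicDir_gaugeDir hUp hlam))
  refine Finset.sum_le_sum fun x _ => Finset.sum_le_sum fun π _ => ?_
  have h := norm_Ad_hol_sub_le hU lam x π.1.1 π.1.2
  have h0 : 0 ≤ ‖Ad (fhol U (x, π)) (lam x) - lam x‖ := norm_nonneg _
  rw [fhol] at h0 ⊢
  exact pow_le_pow_left₀ h0 h 2

/-! ## §4 (v1.1) The straight-line form: covariant line sums of covariant differences telescope exactly -/

/-- **LINE STOKES (exact, any units-valued `U`).**  Along the straight segment `[x, x + m e_κ]`: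
`Ad_{U(seg κ m)} λ(x + m e_κ) − λ(x) = −Σ_{i<m} Ad_{U(seg κ i)·U(x + ie_κ, κ)} (gaugeDir U λ (x + ie_κ) κ)` — the transported
covariant differences of a 0-form telescope to the transported endpoint difference (route H♮ S3: the covariant line sum of an exact
field `D_Wζ` IS `Ad_{W(line)}ζ(end) − ζ(start)`). [folklore] -/
theorem Ad_hol_seg_sub_eq (U : Site d → Fin d → (Matrix n n ℂ)ˣ) (lam : Site d → Matrix n n ℂ) (x : Site d) (κ : Fin d) :
    ∀ m : ℕ, Ad (hol U x (seg κ m)) (lam (x + (m : ℤ) • e κ)) - lam x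
      = -∑ i ∈ Finset.range m, Ad (hol U x (seg κ i) * U (x + (i : ℤ) • e κ) κ) (gaugeDir U lam (x + (i : ℤ) • e κ) κ)
  | 0 => by simp [Ad_one]
  | m + 1 => by
    have ih := Ad_hol_seg_sub_eq U lam x κ m
    have hstep : lam (x + ((m + 1 : ℕ) : ℤ) • e κ)
        = Ad (U (x + (m : ℤ) • e κ) κ)⁻¹ (lam (x + (m : ℤ) • e κ)) - gaugeDir U lam (x + (m : ℤ) • e κ) κ := by
      rw [show x + ((m + 1 : ℕ) : ℤ) • e κ = x + (m : ℤ) • e κ + e κ by push_cast; rw [add_smul, one_smul, add_assoc]]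
      exact next_eq U lam _ κ
    rw [show ((m + 1 : ℕ) : ℤ) = (m : ℤ) + 1 by push_cast; rfl, hol_seg_natCast_succ, Finset.sum_range_succ, neg_add, ← ih,
      show x + ((m : ℤ) + 1) • e κ = x + ((m + 1 : ℕ) : ℤ) • e κ by push_cast; rfl, hstep, Ad_sub, Ad_mul, Ad_mul,
      ← Ad_mul (U (x + (m : ℤ) • e κ) κ) (U (x + (m : ℤ) • e κ) κ)⁻¹, mul_inv_cancel, Ad_one]
    abel

/-- The straight-segment transport of a unitary configuration is unitary. [folklore] -/
theorem hol_seg_mem_unitaryUnits {U : Site d → Fin d → (Matrix n n ℂ)ˣ} (hU : IsUnitaryCfg U) (x : Site d) (κ : Fin d) :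
    ∀ m : ℕ, hol U x (seg κ m) ∈ unitaryUnits (Matrix n n ℂ)
  | 0 => by simp [(unitaryUnits (Matrix n n ℂ)).one_mem]
  | j + 1 => by
    rw [show ((j + 1 : ℕ) : ℤ) = (j : ℤ) + 1 by push_cast; rfl, hol_seg_natCast_succ]
    exact (unitaryUnits _).mul_mem (hol_seg_mem_unitaryUnits hU x κ j) (hU _ _)

/-- **`‖Ad_{U([x, x+me_κ])} λ(x + me_κ) − λ(x)‖ ≤ Σ_{i<m} ‖gaugeDir U λ (x + ie_κ) κ‖`** for unitary `U`: a 0-form covariantly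
constant to accuracy `g` along a line of `m` bonds is transported to accuracy `m·g`. [folklore] -/
theorem norm_Ad_hol_seg_sub_le {U : Site d → Fin d → (Matrix n n ℂ)ˣ} (hU : IsUnitaryCfg U) (lam : Site d → Matrix n n ℂ)
    (x : Site d) (κ : Fin d) (m : ℕ) :
    ‖Ad (hol U x (seg κ m)) (lam (x + (m : ℤ) • e κ)) - lam x‖
      ≤ ∑ i ∈ Finset.range m, ‖gaugeDir U lam (x + (i : ℤ) • e κ) κ‖ := by
  rw [Ad_hol_seg_sub_eq, norm_neg]
  refine (norm_sum_le _ _).trans (Finset.sum_le_sum fun i _ => le_of_eq ?_)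
  exact norm_Ad_of_unitary ((unitaryUnits _).mul_mem (hol_seg_mem_unitaryUnits hU x κ i) (hU _ _)) _

end

end Summit.QuantumFields.BalabanUV.T4Continuum.NE3CovariantStokes
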